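import Summits.QuantumFields.BalabanUV.T4Continuum.Support.NE7EtaBackgroundFamilyDocking
import Literature.MathematicalPhysics.QuantumFieldTheory.Balaban1983to89.T4BoundaryCarrier
import HarnessLib

/-!
# NE7EtaBackgroundEndTowers — route #1 of the NE7 crux, stub S7 (NODE O, the BACKGROUND COORDINATE) × NODE T: the term-wise END's THREE
# tower inputs `hUR` (E-kind), `hURB` (boundary kind, every admissible pending field, ONE constant), `hURR` (𝐑-kind) AND its reference
# witness (F′) `hwit`, on ONE selection into `occCarriers`, from the gen-55 minimal bill — the END's background side docked in one theorem

Cell `pub-balaban`, rung (B)+1 sub-cell t4, lineage `b2b-balaban-t4-ne7-p1`, generation 55 (CRUX PROVER NE7 #1, ruling e34b3e0c (2)); crux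
skeleton `t4/skeletons/NE7-CRUX-R1.md` v1.7.14 §2 (`CruxDecl_of` = END p215546 ∘ node T ∘ NODE O).  HONEST FRAMING (page 1): FIXED FINITE T⁴,
rung (B)+1; NE7, NE3 NOT PRINTED in [Balaban1984PropagatorsI]–[Balaban1989LargeFieldII] and NOT PROVED here; continuum YM on T⁴ ⇐ BetaPertH ∧
nine spine estimates (0/9 proved); BetaPertH ⇐ (D1) ∧ (D4) ∧ CAP+tail; G-an2-4 gates asym, D1 and NE2/3/4; NOT infinite volume, NOT mass
gap, NOT Clay.

WHAT ([folklore]; 0 def; 0 sorry).  The END `TermwiseLocalThm1LedgerW.goodClause_summable_UN_levels_of_thm1At_residualW` reads the two runs'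
backgrounds through FOUR binders on ONE pair of selections `uA K`, `uB K` into a boundary carrier `C`: `hUR` (l.92, E-kind functionals
`EA`∕`EB`, constant `Cr`), `hURB` (l.94, boundary functionals `atFl BA b`∕`atFl BB b` for EVERY `b ∈ C.admFl`, ONE constant `EB₀`), `hURR`
(l.97, 𝐑-kind `RA`∕`RB`, constant `CrR`) and (F′) `hwit` (l.132).  THIS FILE produces all four from ONE `hclose`:
 * §1 **`uRateUpTo_of_hclose_indexed`** (ANY carrier, ANY index set `S`): node U3's shapes for every member `j ∈ S` of an indexed family of
   functional pairs with member-uniform data + `hclose` + node U2's `InjectedRate` ⟹ ONE `a ≥ 0` with `URateUpTo K (EAⱼ) (EBⱼ) …` for every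
   cutoff and member (`argBracket_tower` ONCE — it sees only `CU`, `P`, `q`, `C₃`, `θ₃`, `θ′`; generalises `NE7EtaBackgroundFamilyDocking.uRateUpTo_of_hclose_family`).  **`uRateUpToFl_of_hclose`**
   (ANY boundary carrier): the instance `S := C.admFl`, `EAⱼ := atFl BA j` — from `NE9Fl`∕`LipBackgroundFl`∕`NE5B` (`T4BoundaryCarrier`) and
   `hclose` on `C.toCarriers`: LITERALLY the END's `hURB` shape (the hclose-fed twin of `T4TermwiseBoundary.uRateUpToFl_of_tables`, which asks
   the readings liaison `LocalRate`∕`GaugeDominated` instead).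
 * §2 **`endTowers_hwit_occCarriers_of_hmin_ref`** — on the boundary carrier `{ toCarriers := occCarriers …, Fl, admFl }` (ANY pending-field
   data), from the gen-55 minimal bill of the background coordinate (NE3's covariant root amendment 4 with ANY real constants; NE3's (H∃)
   `hmin`; closed-form numerics; `hdom`; sector condition; reference datum `v₁ ∈ dom`) + node U3's shapes for the three kinds + node U2's
   `InjectedRate` + box∕window∕rate letters: selections `uA uB`, reference backgrounds `oneA oneB` and constants `Cr, EB₀, CrR ≥ 0` with
   `hUR` ∧ `hURB` ∧ `hURR` ∧ `hwit` — the END's four background-side binders VERBATIM (`gA K := g K`, `gB K := g (K+1) (·+1)`, `Adm := dom`).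
CONSEQUENCE (skeleton §2).  `CruxDecl_of`'s seam «END ∘ node T ∘ NODE O's background coordinate» is ONE kernel term for the background
side: what the END still asks after it is X-A2's (the functionals `EA EB BA BB RA RB`, the `t`-family of `NE7EtaBackgroundFamilyDocking`,
the format∕ledger∕size binders), NODE B∕R∕S, the weights (NE7b∕NE7c) and rows NE3∕NE4∕NE5∕NE9 behind the shapes.  Nothing in the ask of NE3
changes; route 1 stays KERNEL-COMPLETE AT FORM LEVEL ∕ DEPENDENT; NE7 NOT proved.  HONEST: composition of landed modules; every analytic
input (NE3's root, (H∃), the NE5∕NE9∕Lipschitz shapes of the three kinds, node U2's rate) is a HYPOTHESIS; all functionals are ABSTRACT;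
nothing of [I]–[III] asserted, instantiated or discharged.
-/

set_option autoImplicit false

open scoped BigOperators Matrix Matrix.Norms.L2Operator
open Finset NormedSpace

namespace Summit.QuantumFields.BalabanUV.T4Continuum.NE7EtaBackgroundEndTowers

open Literature.MathematicalPhysics.QuantumFieldTheory.Balaban1983to89
open B7Prop1Explicit B7Prop2Explicit
open T4AveragingDeficitWall hiding Site Plane Plaq Bond
open T4AveragingDeficitWallBoundary (periodBox IsPeriodicCfg)
open MinimalActionSandwich (IsMinimiser)
open MinimalActionRate (Regular sfClass)
open MinimalActionRefine (RegularSup gradConst)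
open T4OutputRate (Carriers Functional NE9 NE5 LipBackground FadingMemory)
open T4BoundaryCarrier (BFunctional atFl NE9Fl LipBackgroundFl NE5B)
open T4TowerRateComposition (PolyLipGrowth URateUpTo argBracket_tower couplingRate_pair_of_injectedDisc)
open T4TowerRateDischarge (uRateUpTo_tower_anyRate box_nonneg)
open T4CauchySum (InjectedRate)
open AveragingDeficitPeriodicCounting (IsPeriodicDir)
open AveragingDeficitTwoLevelPrep (twoLevelSmall)
open NE3EnergyShapes (residualScale IsUnitarySite IsPeriodicSite)
open NE3EnergyWeightedShapes (energyNormW)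
open NE7EtaBackgroundCarrier
open TorusSmallFieldGlobalGauge (sectorConst)
open NE7EtaBackgroundReferenceWitness (hwit_of_hmin_ref)
open NE7EtaBackgroundFamilyDocking (cr_nonneg)

noncomputable section

/-! ## §1 Node U3 along the tower for an indexed family, ONE constant; the boundary kind from `hclose` -/

section AnyCarrier

variable {Car : Carriers} {ι : Type*} {J : Type*}

/-- **NODE U3's RATE ALONG THE TOWER FOR AN INDEXED FAMILY OF FUNCTIONAL PAIRS, ONE CONSTANT** (any carrier, any index set `S`): node U3's
shapes for every member with member-uniform data, the closeness `hclose` of the selections, node U2's `InjectedRate`, both runs' tables in `W`,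
ANY common rate `θ′` ⟹ ONE `a ≥ 0` serving every cutoff and every member. [folklore] -/
theorem uRateUpTo_of_hclose_indexed (S : Set J) {W : Set (ℕ → ℝ)} {EAj : J → Functional Car Car.BgA} {EBj : J → Functional Car Car.BgB}
    {κ θ₅ C₅ C₉ ω θc Cd γ C₃ θ₃ P θ' : ℝ} {q : ℕ} {Λ : ℕ → ℕ → ℝ} {CU : (ℕ → ℝ) → ℕ → ℝ} {g : ℕ → ℕ → ℝ}
    {uA : ℕ → ι → Car.BgA} {uB : ℕ → ι → Car.BgB} {dom : Set ι}
    (h9 : ∀ j ∈ S, NE9 (EAj j) W κ Λ) (hΛ : FadingMemory C₉ ω Λ) (hω : 0 ≤ ω)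
    (hU : ∀ j ∈ S, LipBackground (EAj j) W κ CU) (hG : PolyLipGrowth CU g P q) (hP : 0 ≤ P)
    (h5 : ∀ j ∈ S, NE5 (EAj j) (EBj j) W κ θ₅ C₅) (hθ₅ : 0 ≤ θ₅) (hC₅ : 0 ≤ C₅)
    (hclose : ∀ K : ℕ, ∀ v ∈ dom, Car.gauge (uA K v) (Car.transport (uB K v)) ≤ C₃ * θ₃ ^ K)
    (hC₃ : 0 ≤ C₃) (hθ₃ : 0 ≤ θ₃) (hθ₃1 : θ₃ < 1)
    (hinj : InjectedRate Cd 0 θc (fun K j => T4CouplingMatching.disc (g K) (g (K + 1)) j)) (hCd : 0 ≤ Cd)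
    (hθc : 0 ≤ θc) (hbox : ∀ K i, i ≤ K → 0 < g K i ∧ g K i ≤ γ)
    (hgA : ∀ K, g K ∈ W) (hgB : ∀ K, (fun i => g (K + 1) (i + 1)) ∈ W)
    (hθ' : max ω θc < θ') (hθ₅' : θ₅ ≤ θ') (hθ₃' : θ₃ ≤ θ') :
    ∃ a : ℝ, 0 ≤ a ∧ ∀ (K : ℕ), ∀ j ∈ S,
      URateUpTo K (EAj j) (EBj j) (g K) (fun i => g (K + 1) (i + 1)) (uA K) (uB K) dom
        (a + C₉ * (γ ^ 3 * Cd) * (θ' / (θ' - max ω θc)) + C₅) θ' κ := by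
  obtain ⟨a, ha0, harg⟩ := argBracket_tower (δc := fun K => C₃ * θ₃ ^ K) hG hP hC₃ hθ₃ hθ₃1 hθ₃'
    (fun K => by positivity) (fun K => le_rfl)
  have hD : 0 ≤ γ ^ 3 * Cd := mul_nonneg (pow_nonneg (box_nonneg hbox) 3) hCd
  refine ⟨a, ha0, fun K j hj => ?_⟩
  exact uRateUpTo_tower_anyRate (gB := fun K i => g (K + 1) (i + 1)) (Adm := fun _ => dom)
    (δc := fun K => C₃ * θ₃ ^ K) (h9 j hj) hΛ (hU j hj) (h5 j hj) hω hθc hθ₅ (hθ₃.trans hθ₃') hC₅ hD ha0 hθ' hθ₅' le_rfl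
    hgA hgB (fun K i hi => couplingRate_pair_of_injectedDisc hinj hbox K i hi) hclose (fun K j hj => (hG K j hj).1) harg K

end AnyCarrier

section Boundary

variable {C : T4BoundaryCarrier.Carriers} {ι : Type*}

/-- **THE BOUNDARY KIND's TOWER FROM `hclose`, EVERY ADMISSIBLE PENDING FIELD, ONE CONSTANT** (any boundary carrier): the END's `hURB` shape
`∀ b ∈ C.admFl, ∀ K, URateUpTo K (atFl BA b) (atFl BB b) …` from node U3.B's shapes `NE9Fl`∕`LipBackgroundFl`∕`NE5B` (`T4BoundaryCarrier`),
`hclose` on `C.toCarriers`, node U2's `InjectedRate` — `uRateUpTo_of_hclose_indexed` at `S := C.admFl`; the `hclose`-fed twin of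
`T4TermwiseBoundary.uRateUpToFl_of_tables`. [folklore] -/
theorem uRateUpToFl_of_hclose {W : Set (ℕ → ℝ)} {BA : BFunctional C C.BgA} {BB : BFunctional C C.BgB}
    {κ θ₅ C₅ C₉ ω θc Cd γ C₃ θ₃ P θ' : ℝ} {q : ℕ} {Λ : ℕ → ℕ → ℝ} {CU : (ℕ → ℝ) → ℕ → ℝ} {g : ℕ → ℕ → ℝ}
    {uA : ℕ → ι → C.BgA} {uB : ℕ → ι → C.BgB} {dom : Set ι}
    (h9 : NE9Fl BA W κ Λ) (hΛ : FadingMemory C₉ ω Λ) (hω : 0 ≤ ω)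
    (hU : LipBackgroundFl BA W κ CU) (hG : PolyLipGrowth CU g P q) (hP : 0 ≤ P)
    (h5 : NE5B BA BB W κ θ₅ C₅) (hθ₅ : 0 ≤ θ₅) (hC₅ : 0 ≤ C₅)
    (hclose : ∀ K : ℕ, ∀ v ∈ dom, C.gauge (uA K v) (C.transport (uB K v)) ≤ C₃ * θ₃ ^ K)
    (hC₃ : 0 ≤ C₃) (hθ₃ : 0 ≤ θ₃) (hθ₃1 : θ₃ < 1)
    (hinj : InjectedRate Cd 0 θc (fun K j => T4CouplingMatching.disc (g K) (g (K + 1)) j)) (hCd : 0 ≤ Cd)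
    (hθc : 0 ≤ θc) (hbox : ∀ K i, i ≤ K → 0 < g K i ∧ g K i ≤ γ)
    (hgA : ∀ K, g K ∈ W) (hgB : ∀ K, (fun i => g (K + 1) (i + 1)) ∈ W)
    (hθ' : max ω θc < θ') (hθ₅' : θ₅ ≤ θ') (hθ₃' : θ₃ ≤ θ') :
    ∃ a : ℝ, 0 ≤ a ∧ ∀ b ∈ C.admFl, ∀ K : ℕ,
      URateUpTo K (atFl BA b) (atFl BB b) (g K) (fun i => g (K + 1) (i + 1)) (uA K) (uB K) dom
        (a + C₉ * (γ ^ 3 * Cd) * (θ' / (θ' - max ω θc)) + C₅) θ' κ := by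
  obtain ⟨a, ha, hrate⟩ := uRateUpTo_of_hclose_indexed (Car := C.toCarriers) C.admFl (EAj := fun b => atFl BA b)
    (EBj := fun b => atFl BB b) h9 hΛ hω hU hG hP h5 hθ₅ hC₅ hclose hC₃ hθ₃ hθ₃1 hinj hCd hθc hbox hgA hgB hθ' hθ₅' hθ₃'
  exact ⟨a, ha, fun b hb K => hrate K b hb⟩

end Boundary

/-! ## §2 The END's four background-side binders on ONE selection into `occCarriers` -/

section Background

variable {n : Type} [Fintype n] [DecidableEq n] [Nonempty n]

/-- **THE END's `hUR`, `hURB`, `hURR` AND (F′) `hwit` FROM ONE SELECTION, ON THE BOUNDARY CARRIER OVER `occCarriers`** (ANY pending-field data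
`Fl`, `admFl`): hypotheses = the gen-55 minimal bill of NODE O's background coordinate (NE3's covariant root amendment 4 with ANY real `C, Λ₁,
Λ₂′`; NE3's (H∃) `hmin`; `0 ≤ b ≤ ε`, `512·5·8·L²·b ≤ 1`, `16·C₀·ε ≤ 3`, `2·twoLevelSmall 4 L·ε ≤ L²`, `gradConst 4 c ≤ g`; `hdom`; the sector
condition; a reference datum `v₁ ∈ dom`) + node U3's shapes for the E-kind (`EA`∕`EB`), the boundary kind (`BA`∕`BB`: `NE9Fl`∕`LipBackgroundFl`∕
`NE5B`) and the 𝐑-kind (`RA`∕`RB`) with ONE window `W`, decay `κ`, history moduli and common rate `θ′ ≥ θ = L^{−1∕6}` (per-kind Lipschitz tables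
and NE5 constants) + node U2's `InjectedRate` on the printed box.  CONCLUSION: `uA uB oneA oneB` and `Cr, EB₀, CrR ≥ 0` with the END's
`hUR` (l.92), `hURB` (l.94), `hURR` (l.97) and `hwit` (l.132) VERBATIM (`gA K := gtab K`, `gB K := gtab (K+1) (·+1)`, `Adm := dom`).  HONEST: every
analytic input is a HYPOTHESIS; all six functionals are ABSTRACT (X-A2); nothing of NE3∕NE5∕NE9∕NE7 discharged. [folklore] -/
theorem endTowers_hwit_occCarriers_of_hmin_ref {L N : ℕ} (hL : 2 ≤ L) (hN : 1 ≤ N) {θ : ℝ} (hθ : 0 < θ)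
    (hθ6 : θ ^ 6 = ((L : ℝ))⁻¹) {ε b c : ℝ} (hb : 0 ≤ b) (hbε : b ≤ ε)
    (hbs : 512 * (4 + 1) * (4 + 4) * (L : ℝ) ^ 2 * b ≤ 1)
    (hε1 : 16 * C0 4 * ε ≤ 3) (h2line : 2 * twoLevelSmall 4 L * ε ≤ (L : ℝ) ^ 2)
    {g C Λ₁ Λ₂' : ℝ} (hgc : gradConst 4 c ≤ g)
    {dom : Set (Site 4 → Fin 4 → (Matrix n n ℂ)ˣ)}
    (hdom : ∀ v ∈ dom, ∀ w : Site 4 → (Matrix n n ℂ)ˣ, IsUnitarySite w → IsPeriodicSite w (N : ℤ) → gaugeAct w v ∈ dom)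
    (hmin : ∀ V ∈ dom, ∀ k : ℕ, ∃ U, IsMinimiser 4 (sfClass 4 L N ε) L N k V U ∧ RegularSup 4 L N b c k U)
    (h : ∀ k : ℕ, 1 ≤ k → ∀ V ∈ dom, ∀ UA UB : Site 4 → Fin 4 → (Matrix n n ℂ)ˣ,
      IsMinimiser 4 (sfClass 4 L N ε) L N k V UA → IsMinimiser 4 (sfClass 4 L N ε) L N (k + 1) V UB →
        Regular 4 L N b g (k + 1) UB →
        ∃ (u : Site 4 → (Matrix n n ℂ)ˣ) (Z : Site 4 → Fin 4 → Matrix n n ℂ),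
          IsUnitarySite u ∧ IsPeriodicSite u ((N * L ^ k : ℕ) : ℤ) ∧
          IsSkewDir Z ∧ IsPeriodicDir Z ((N * L ^ k : ℕ) : ℤ) ∧
          gaugeAct u UA = vary (rescale L (bavg L UB)) Z 1 ∧
          energyNormW L k (rescale L (bavg L UB)) Z (periodBox (N * L ^ k)) ≤ C * residualScale 4 L N b g k ∧
          (∀ (κ : Fin 4) (x : Site 4) (μ : Fin 4),
            ‖Ad (rescale L (bavg L UB) (x + e κ) μ) (Z (x + e μ) κ) - Z x κ‖ ≤ Λ₁ * (((L : ℝ)⁻¹) ^ k) ^ 2) ∧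
          (∀ (κ μ : Fin 4) (y : Site 4),
            ‖Ad (rescale L (bavg L UB) (y + e κ) μ)
                (Ad (rescale L (bavg L UB) (y + e κ + e μ) μ) (Z (y + (2 : ℕ) • e μ) κ) - Z (y + e μ) κ)
              - (Ad (rescale L (bavg L UB) (y + e κ) μ) (Z (y + e μ) κ) - Z y κ)‖ ≤ Λ₂' * (((L : ℝ)⁻¹) ^ k) ^ 3))
    (hsector : (Fintype.card n : ℝ) * (N : ℝ) ^ 2 * ε ≤ sectorConst n)
    {v₁ : Site 4 → Fin 4 → (Matrix n n ℂ)ˣ} (hv₁ : v₁ ∈ dom)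
    (D : Type) (sc : D → ℕ) (dl : D → ℝ) (hdl : ∀ X, 0 ≤ dl X) (Fl : Type) (admFl : Set Fl)
    -- the shared data: window, decay, history moduli, node U2's output on the printed box, the common rate
    {W : Set (ℕ → ℝ)} {κ C₉ ω θc Cd γg θ' : ℝ} {Λ : ℕ → ℕ → ℝ} {gtab : ℕ → ℕ → ℝ}
    (hΛ : FadingMemory C₉ ω Λ) (hω : 0 ≤ ω)
    (hinj : InjectedRate Cd 0 θc (fun K j => T4CouplingMatching.disc (gtab K) (gtab (K + 1)) j)) (hCd : 0 ≤ Cd)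
    (hθc : 0 ≤ θc) (hbox : ∀ K i, i ≤ K → 0 < gtab K i ∧ gtab K i ≤ γg)
    (hgA : ∀ K, gtab K ∈ W) (hgB : ∀ K, (fun i => gtab (K + 1) (i + 1)) ∈ W)
    (hθ' : max ω θc < θ') (hθθ' : θ ≤ θ')
    -- E-kind: node U3's shapes for `EA`, `EB`
    {EA : Functional ({ toCarriers := occCarriers n L N ε dom D sc dl hdl, Fl := Fl, admFl := admFl } :
        T4BoundaryCarrier.Carriers).toCarriers (occCarriers n L N ε dom D sc dl hdl).BgA}
    {EB : Functional ({ toCarriers := occCarriers n L N ε dom D sc dl hdl, Fl := Fl, admFl := admFl } :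
        T4BoundaryCarrier.Carriers).toCarriers (occCarriers n L N ε dom D sc dl hdl).BgB}
    {θ₅ C₅ P : ℝ} {q : ℕ} {CU : (ℕ → ℝ) → ℕ → ℝ}
    (h9 : NE9 EA W κ Λ) (hU : LipBackground EA W κ CU) (hG : PolyLipGrowth CU gtab P q) (hP : 0 ≤ P)
    (h5 : NE5 EA EB W κ θ₅ C₅) (hθ₅ : 0 ≤ θ₅) (hC₅ : 0 ≤ C₅) (hθ₅' : θ₅ ≤ θ')
    -- boundary kind: node U3.B's shapes for `BA`, `BB`
    {BA : BFunctional ({ toCarriers := occCarriers n L N ε dom D sc dl hdl, Fl := Fl, admFl := admFl } : T4BoundaryCarrier.Carriers)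
        (occCarriers n L N ε dom D sc dl hdl).BgA}
    {BB : BFunctional ({ toCarriers := occCarriers n L N ε dom D sc dl hdl, Fl := Fl, admFl := admFl } : T4BoundaryCarrier.Carriers)
        (occCarriers n L N ε dom D sc dl hdl).BgB}
    {θ₅B C₅B PB : ℝ} {qB : ℕ} {CUB : (ℕ → ℝ) → ℕ → ℝ}
    (h9B : NE9Fl BA W κ Λ) (hUB : LipBackgroundFl BA W κ CUB) (hGB : PolyLipGrowth CUB gtab PB qB) (hPB : 0 ≤ PB)
    (h5B : NE5B BA BB W κ θ₅B C₅B) (hθ₅B : 0 ≤ θ₅B) (hC₅B : 0 ≤ C₅B) (hθ₅B' : θ₅B ≤ θ')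
    -- 𝐑-kind: node U3's shapes for `RA`, `RB`
    {RA : Functional ({ toCarriers := occCarriers n L N ε dom D sc dl hdl, Fl := Fl, admFl := admFl } :
        T4BoundaryCarrier.Carriers).toCarriers (occCarriers n L N ε dom D sc dl hdl).BgA}
    {RB : Functional ({ toCarriers := occCarriers n L N ε dom D sc dl hdl, Fl := Fl, admFl := admFl } :
        T4BoundaryCarrier.Carriers).toCarriers (occCarriers n L N ε dom D sc dl hdl).BgB}
    {θ₅R C₅R PR : ℝ} {qR : ℕ} {CUR : (ℕ → ℝ) → ℕ → ℝ}
    (h9R : NE9 RA W κ Λ) (hUR' : LipBackground RA W κ CUR) (hGR : PolyLipGrowth CUR gtab PR qR) (hPR : 0 ≤ PR)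
    (h5R : NE5 RA RB W κ θ₅R C₅R) (hθ₅R : 0 ≤ θ₅R) (hC₅R : 0 ≤ C₅R) (hθ₅R' : θ₅R ≤ θ') :
    ∃ (uA : ℕ → (Site 4 → Fin 4 → (Matrix n n ℂ)ˣ) → (occCarriers n L N ε dom D sc dl hdl).BgA)
      (uB : ℕ → (Site 4 → Fin 4 → (Matrix n n ℂ)ˣ) → (occCarriers n L N ε dom D sc dl hdl).BgB)
      (oneA : (occCarriers n L N ε dom D sc dl hdl).BgA) (oneB : (occCarriers n L N ε dom D sc dl hdl).BgB) (Cr EB₀ CrR : ℝ),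
      0 ≤ Cr ∧ 0 ≤ EB₀ ∧ 0 ≤ CrR ∧
      -- `hUR` (l.92)
      (∀ K : ℕ, URateUpTo K EA EB (gtab K) (fun i => gtab (K + 1) (i + 1)) (uA K) (uB K) dom Cr θ' κ) ∧
      -- `hURB` (l.94)
      (∀ bfl ∈ admFl, ∀ K : ℕ,
        URateUpTo K (atFl BA bfl) (atFl BB bfl) (gtab K) (fun i => gtab (K + 1) (i + 1)) (uA K) (uB K) dom EB₀ θ' κ) ∧
      -- `hURR` (l.97)
      (∀ K : ℕ, URateUpTo K RA RB (gtab K) (fun i => gtab (K + 1) (i + 1)) (uA K) (uB K) dom CrR θ' κ) ∧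
      -- `hwit` (l.132)
      (∀ K : ℕ, ∃ v₁ ∈ dom, uA K v₁ = oneA ∧ uB K v₁ = oneB) := by
  obtain ⟨uA, uB, oneA, oneB, C₃, hC₃, hclose, hwit⟩ := hwit_of_hmin_ref hL hN hθ hθ6 hb hbε hbs hε1 h2line hgc hdom hmin h
    hsector hv₁ D sc dl hdl
  have hθ1 : θ < 1 := theta_lt_one hL hθ hθ6
  -- E-kind: the one-member family
  obtain ⟨a, ha, hE⟩ := uRateUpTo_of_hclose_indexed (Car := occCarriers n L N ε dom D sc dl hdl) (Set.univ : Set Unit)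
    (EAj := fun _ => EA) (EBj := fun _ => EB) (fun _ _ => h9) hΛ hω (fun _ _ => hU) hG hP (fun _ _ => h5) hθ₅ hC₅ hclose hC₃
    hθ.le hθ1 hinj hCd hθc hbox hgA hgB hθ' hθ₅' hθθ'
  -- boundary kind: every admissible pending field, one constant
  obtain ⟨aB, haB, hB⟩ := uRateUpToFl_of_hclose
    (C := ({ toCarriers := occCarriers n L N ε dom D sc dl hdl, Fl := Fl, admFl := admFl } : T4BoundaryCarrier.Carriers))
    h9B hΛ hω hUB hGB hPB h5B hθ₅B hC₅B hclose hC₃ hθ.le hθ1 hinj hCd hθc hbox hgA hgB hθ' hθ₅B' hθθ'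
  -- 𝐑-kind
  obtain ⟨aR, haR, hR⟩ := uRateUpTo_of_hclose_indexed (Car := occCarriers n L N ε dom D sc dl hdl) (Set.univ : Set Unit)
    (EAj := fun _ => RA) (EBj := fun _ => RB) (fun _ _ => h9R) hΛ hω (fun _ _ => hUR') hGR hPR (fun _ _ => h5R) hθ₅R hC₅R hclose
    hC₃ hθ.le hθ1 hinj hCd hθc hbox hgA hgB hθ' hθ₅R' hθθ'
  exact ⟨uA, uB, oneA, oneB, _, _, _, cr_nonneg hΛ hω hCd hbox hC₅ ha hθ', cr_nonneg hΛ hω hCd hbox hC₅B haB hθ',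
    cr_nonneg hΛ hω hCd hbox hC₅R haR hθ', fun K => hE K () (Set.mem_univ _), hB, fun K => hR K () (Set.mem_univ _), hwit⟩

end Background

end

end Summit.QuantumFields.BalabanUV.T4Continuum.NE7EtaBackgroundEndTowers
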